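import Mathlib
import Summits.Ventures.PercRepro2.BHKOutside
import Summits.Ventures.PercRepro2.OrderPreservation

/-!
# The mirror half of the one-bridge class theorem: two one-cluster inequalities with an outside
connection (blind cell PercRepro2, p5 g27; `proofs/P5-OEDGE.md` §35 addendum 1 (4))

For the cluster `C = C(s)` of `s` under the product measure and marks `o, v, y`, with
`O = {o ∈ C}`, `C_y = {y ∈ C}`, `Y_v = {v ↔ y}`, `Y_o = {o ↔ y}` (connections in the whole graph):

* `hb0 := P(Y_o ∩ Y_vᶜ ∩ C_yᶜ) + P(O)·P(Y_v ∩ C_yᶜ) − P(O ∩ Y_v ∩ C_yᶜ) ≥ 0`   (`hb0_nonneg`),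
* `hb1 := (1 − P(C_y))·[P(Y_o ∩ Y_vᶜ ∩ C_yᶜ) − P(O ∩ Y_v ∩ C_yᶜ)] + P(Y_v ∩ C_yᶜ)·[P(O ∩ C_yᶜ) + P(Y_o ∩ C_yᶜ)] ≥ 0`
  (`hb1_nonneg`).

Both are the two ends `u = 0, 1` of the affine function `Hb(u)` with
`groupH = P(Q, b ∈ C₂)·u·Hb(u)`, `u = t·α`, in the one-bridge family (`a₁, b` on one side, `a₂ = s`
and `o, v` on the other, the bridge landing at `y`): together with `ClusterThreePoint` and
`ClusterThreeMark` they are the one-cluster content of the one-bridge class theorem for row (LEAF-½).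
Both follow from ONE inequality — `BHKOutside.bhk_inside_outside_avoid` (an increasing event of `C_s`
and «`y ∈ C_v` off `C_s`» are negatively correlated under an avoidance), at `X = ∅`
(`outside_single`: `P(O ∩ Y_v ∩ C_yᶜ) ≤ P(O)·P(Y_v ∩ C_yᶜ)`) and at `X = {y}`
(`outside_pair`: `P(O ∩ Y_v ∩ C_yᶜ)·P(C_yᶜ) ≤ P(O ∩ C_yᶜ)·P(Y_v ∩ C_yᶜ)`) — using that on `{v ↔ y}`
the avoidances `s ↮ v`, `s ↮ y`, `s ↮ {v, y}` coincide (`connEvent_inter_avoid_v`,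
`connEvent_inter_avoid_vy`).  Nothing here claims (G2) or the class theorem (the bridge tower is paper).
-/

namespace Summit.Ventures.PercRepro2

namespace ClusterOutsideMark

variable {V : Type*} {E : Type*} [Fintype E] [DecidableEq E] [Fintype V] [DecidableEq V]
  {R : Type*} [Field R] [LinearOrder R] [IsStrictOrderedRing R]

variable (p : E → R) (ends : E → Sym2 V)

omit [Fintype E] [DecidableEq E] [Fintype V] [DecidableEq V] in
/-- On `{v ↔ y}`, `s ↮ v` is `s ↮ y`. -/
lemma connEvent_inter_avoid_v (s v y : V) :
    connEvent ends v y ∩ avoidAll ends s {v} = connEvent ends v y ∩ (connEvent ends s y)ᶜ := by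
  ext ω
  simp only [Set.mem_inter_iff, mem_connEvent, avoidAll, Set.mem_setOf_eq, Finset.mem_singleton,
    forall_eq, Set.mem_compl_iff]
  constructor
  · rintro ⟨hvy, hsv⟩
    exact ⟨hvy, fun hsy => hsv (conn_trans hsy (conn_symm hvy))⟩
  · rintro ⟨hvy, hsy⟩
    exact ⟨hvy, fun hsv => hsy (conn_trans hsv hvy)⟩

omit [Fintype E] [DecidableEq E] [Fintype V] in
/-- On `{v ↔ y}`, `s ↮ {v, y}` is `s ↮ y`. -/
lemma connEvent_inter_avoid_vy (s v y : V) :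
    connEvent ends v y ∩ avoidAll ends s {v, y} = connEvent ends v y ∩ (connEvent ends s y)ᶜ := by
  ext ω
  simp only [Set.mem_inter_iff, mem_connEvent, avoidAll, Set.mem_setOf_eq, Finset.mem_insert,
    Finset.mem_singleton, Set.mem_compl_iff]
  constructor
  · rintro ⟨hvy, h⟩
    exact ⟨hvy, h y (Or.inr rfl)⟩
  · rintro ⟨hvy, hsy⟩
    refine ⟨hvy, fun x hx => ?_⟩
    rcases hx with rfl | rfl
    · exact fun hsv => hsy (conn_trans hsv hvy)
    · exact hsy

omit [Fintype E] [DecidableEq E] [Fintype V] [DecidableEq V] in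
/-- `s ↮ ∅` is the sure event. -/
lemma avoidAll_empty (s : V) : avoidAll ends s (∅ : Finset V) = Set.univ := by
  ext ω
  simp [avoidAll]

/-- **The single-avoidance instance** (`bhk_inside_outside_avoid` at `X = ∅`):
`P(O ∩ Y_v ∩ C_yᶜ) ≤ P(O)·P(Y_v ∩ C_yᶜ)`. -/
theorem outside_single (hp : IsProbVec p) (s o v y : V) :
    prob p (connEvent ends s o ∩ (connEvent ends v y ∩ (connEvent ends s y)ᶜ)) ≤
      prob p (connEvent ends s o) * prob p (connEvent ends v y ∩ (connEvent ends s y)ᶜ) := by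
  have h := bhk_inside_outside_avoid p hp ends s v (∅ : Finset V) (isUpperSet_mem_setOf o)
    (isUpperSet_mem_setOf y)
  rw [← connEvent_eq_clusterInEvent ends s o, ← connEvent_eq_clusterInEvent ends v y,
    avoidAll_empty, prob_univ, mul_one, Set.inter_univ, Set.inter_assoc,
    show insert v (∅ : Finset V) = {v} from rfl, connEvent_inter_avoid_v] at h
  exact h

/-- **The pair-avoidance instance** (`bhk_inside_outside_avoid` at `X = {y}`):
`P(O ∩ Y_v ∩ C_yᶜ)·P(C_yᶜ) ≤ P(O ∩ C_yᶜ)·P(Y_v ∩ C_yᶜ)`. -/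
theorem outside_pair (hp : IsProbVec p) (s o v y : V) :
    prob p (connEvent ends s o ∩ (connEvent ends v y ∩ (connEvent ends s y)ᶜ)) *
        prob p (connEvent ends s y)ᶜ ≤
      prob p (connEvent ends s o ∩ (connEvent ends s y)ᶜ) *
        prob p (connEvent ends v y ∩ (connEvent ends s y)ᶜ) := by
  have h := bhk_inside_outside_avoid p hp ends s v ({y} : Finset V) (isUpperSet_mem_setOf o)
    (isUpperSet_mem_setOf y)
  have hs : avoidAll ends s ({y} : Finset V) = (connEvent ends s y)ᶜ := by
    ext ω
    simp only [avoidAll, Set.mem_setOf_eq, Finset.mem_singleton, forall_eq, Set.mem_compl_iff,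
      mem_connEvent]
  rw [← connEvent_eq_clusterInEvent ends s o, ← connEvent_eq_clusterInEvent ends v y, hs,
    Set.inter_assoc, show insert v ({y} : Finset V) = {v, y} from rfl,
    connEvent_inter_avoid_vy] at h
  exact h

/-! ## The two ends of `Hb` -/

/-- `hb0 = P(Y_o ∩ Y_vᶜ ∩ C_yᶜ) + P(O)·P(Y_v ∩ C_yᶜ) − P(O ∩ Y_v ∩ C_yᶜ)` (the value `Hb(0)`). -/
noncomputable def hb0 (s o v y : V) : R :=
  prob p (connEvent ends o y ∩ (connEvent ends v y)ᶜ ∩ (connEvent ends s y)ᶜ) +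
    prob p (connEvent ends s o) * prob p (connEvent ends v y ∩ (connEvent ends s y)ᶜ) -
    prob p (connEvent ends s o ∩ (connEvent ends v y ∩ (connEvent ends s y)ᶜ))

/-- `hb1 = (1 − P(C_y))·[P(Y_o ∩ Y_vᶜ ∩ C_yᶜ) − P(O ∩ Y_v ∩ C_yᶜ)] + P(Y_v ∩ C_yᶜ)·[P(O ∩ C_yᶜ) + P(Y_o ∩ C_yᶜ)]`
(the value `Hb(1)`). -/
noncomputable def hb1 (s o v y : V) : R :=
  (1 - prob p (connEvent ends s y)) *
      (prob p (connEvent ends o y ∩ (connEvent ends v y)ᶜ ∩ (connEvent ends s y)ᶜ) -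
        prob p (connEvent ends s o ∩ (connEvent ends v y ∩ (connEvent ends s y)ᶜ))) +
    prob p (connEvent ends v y ∩ (connEvent ends s y)ᶜ) *
      (prob p (connEvent ends s o ∩ (connEvent ends s y)ᶜ) +
        prob p (connEvent ends o y ∩ (connEvent ends s y)ᶜ))

/-- **`Hb(0) ≥ 0`.** -/
theorem hb0_nonneg (hp : IsProbVec p) (s o v y : V) : 0 ≤ hb0 p ends s o v y := by
  have h := outside_single p ends hp s o v y
  have h0 := prob_nonneg hp (connEvent ends o y ∩ (connEvent ends v y)ᶜ ∩ (connEvent ends s y)ᶜ)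
  unfold hb0
  linarith

/-- **`Hb(1) ≥ 0`.** -/
theorem hb1_nonneg (hp : IsProbVec p) (s o v y : V) : 0 ≤ hb1 p ends s o v y := by
  have h := outside_pair p ends hp s o v y
  have hc := prob_compl p (connEvent ends s y)
  have h0 := prob_nonneg hp (connEvent ends o y ∩ (connEvent ends v y)ᶜ ∩ (connEvent ends s y)ᶜ)
  have h1 := prob_nonneg hp (connEvent ends v y ∩ (connEvent ends s y)ᶜ)
  have h2 := prob_nonneg hp (connEvent ends o y ∩ (connEvent ends s y)ᶜ)
  have h3 := prob_nonneg hp (connEvent ends s y)ᶜ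
  unfold hb1
  rw [← hc]
  nlinarith [mul_nonneg h1 h2, mul_nonneg h3 h0]

/-- **`Hb` is nonnegative on `[0, 1]`**: `(1 − u)·hb0 + u·hb1 ≥ 0` for `0 ≤ u ≤ 1` (the affine
interpolation of the two ends — the form in which the mirror half of the one-bridge family is
`P(Q, b ∈ C₂)·u·Hb(u)`). -/
theorem hb_interp_nonneg (hp : IsProbVec p) (s o v y : V) {u : R} (hu0 : 0 ≤ u) (hu1 : u ≤ 1) :
    0 ≤ (1 - u) * hb0 p ends s o v y + u * hb1 p ends s o v y :=
  add_nonneg (mul_nonneg (sub_nonneg.2 hu1) (hb0_nonneg p ends hp s o v y))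
    (mul_nonneg hu0 (hb1_nonneg p ends hp s o v y))

end ClusterOutsideMark

end Summit.Ventures.PercRepro2
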